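import Mathlib
import Summits.Ventures.PercRepro2.IteratedBK

/-! # Series splitting for the connection event (seat mine-b, cell pub-perc-repro2)
Two edge sets `E₁`, `E₂` that share only the cut vertex `v` (`SharesOnlyVertex`), with `s` touched
only by `E₁` and `t` only by `E₂`: every carrying set for `s–t` carries `s–v` inside `E₁` and `v–t`
inside `E₂` (`carries_series_split`), and `k` disjoint witnesses split and merge accordingly
(`kDisj_series_split`, `kDisj_series_merge`) — the combinatorial content of `F = min(F₁, F₂)` for
a series composition.  `SeriesSum.lean` draws the probabilistic conclusion. -/

open Finset
namespace Summit.Ventures.PercRepro2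

section SeriesSplit

variable {V : Type*} {E : Type*} [Fintype E] [DecidableEq E]

/-- the parts share only the vertex `v`: a vertex incident to edges of both parts is `v` -/
def SharesOnlyVertex (ends : E → Sym2 V) (v : V) (E₁ E₂ : Finset E) : Prop :=
  ∀ e₁ ∈ E₁, ∀ e₂ ∈ E₂, ∀ x, x ∈ ends e₁ → x ∈ ends e₂ → x = v

omit [Fintype E] [DecidableEq E] in
/-- symmetric in the parts -/
lemma SharesOnlyVertex.symm {ends : E → Sym2 V} {v : V} {E₁ E₂ : Finset E}
    (h : SharesOnlyVertex ends v E₁ E₂) : SharesOnlyVertex ends v E₂ E₁ :=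
  fun e₂ h₂ e₁ h₁ x hx₂ hx₁ => h e₁ h₁ e₂ h₂ x hx₁ hx₂

omit [Fintype E] in
/-- a walk of `K`-edges from a vertex touched by a `K ∩ E₁`-edge reaches `v` inside `E₁` before
it can end at a vertex `t` not touched by `E₁` -/
lemma conn_cut_of_walk {ends : E → Sym2 V} {v : V} {E₁ E₂ : Finset E}
    (hE : SharesOnlyVertex ends v E₁ E₂) {K : Finset E} (hK : K ⊆ E₁ ∪ E₂) :
    ∀ {u x : V} (_w : (openGraph ends (ofFinset K)).Walk u x), (∀ e ∈ E₁, x ∉ ends e) → x ≠ v →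
      (u = v ∨ ∃ e ∈ K ∩ E₁, u ∈ ends e) → Conn ends (ofFinset (K ∩ E₁)) u v := by
  intro u x w
  induction w with
  | nil =>
    intro ht _
    rintro (h | ⟨e, he, hue⟩)
    · rw [h]; exact conn_refl _ _ _
    · exact absurd hue (ht e (Finset.mem_of_mem_inter_right he))
  | @cons u u' _ hadj w' ih =>
    intro ht htv
    rintro (h | ⟨e, he, hue⟩)
    · rw [h]; exact conn_refl _ _ _
    · by_cases huv : u = v
      · rw [huv]; exact conn_refl _ _ _
      · rw [openGraph_adj] at hadj
        obtain ⟨_, e', he'open, he'ends⟩ := hadj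
        have he'K : e' ∈ K := ofFinset_eq_true_iff.1 he'open
        have hu : u ∈ ends e' := by rw [he'ends]; exact Sym2.mem_mk_left u u'
        have he'E₁ : e' ∈ E₁ := by
          rcases Finset.mem_union.1 (hK he'K) with h1 | h1
          · exact h1
          · exact absurd (hE e (Finset.mem_of_mem_inter_right he) e' h1 u hue hu) huv
        have hadj' : OpenAdj ends (ofFinset (K ∩ E₁)) u u' :=
          ⟨e', ofFinset_eq_true_iff.2 (Finset.mem_inter.2 ⟨he'K, he'E₁⟩), he'ends⟩
        have hu'e : u' ∈ ends e' := by rw [he'ends]; exact Sym2.mem_mk_right u u'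
        have hrest := ih ht htv (Or.inr ⟨e', Finset.mem_inter.2 ⟨he'K, he'E₁⟩, hu'e⟩)
        exact conn_trans (conn_of_openAdj hadj') hrest

omit [Fintype E] in
/-- **a carrying set splits at the cut vertex**: if `K ⊆ E₁ ∪ E₂` carries `s` to `t`, `s` is touched
only by `E₁`, `t` only by `E₂`, then `K ∩ E₁` carries `s` to `v` and `K ∩ E₂` carries `v` to `t` -/
lemma carries_series_split {ends : E → Sym2 V} {s v t : V} {E₁ E₂ : Finset E}
    (hE : SharesOnlyVertex ends v E₁ E₂) (hs : ∀ e ∈ E₂, s ∉ ends e) (ht : ∀ e ∈ E₁, t ∉ ends e)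
    (hsv : s ≠ v) (htv : t ≠ v) (hst : s ≠ t) {K : Finset E} (hK : K ⊆ E₁ ∪ E₂)
    (hc : Carries ends K s t) :
    Carries ends (K ∩ E₁) s v ∧ Carries ends (K ∩ E₂) v t := by
  obtain ⟨w⟩ := hc
  constructor
  · -- walk from `s`: the first edge is in `E₁`
    cases w with
    | nil => exact absurd rfl hst
    | @cons _ u _ hadj w' =>
      rw [openGraph_adj] at hadj
      obtain ⟨_, e, heopen, heends⟩ := hadj
      have heK : e ∈ K := ofFinset_eq_true_iff.1 heopen
      have hse : s ∈ ends e := by rw [heends]; exact Sym2.mem_mk_left s u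
      have heE₁ : e ∈ E₁ := by
        rcases Finset.mem_union.1 (hK heK) with h1 | h1
        · exact h1
        · exact absurd hse (hs e h1)
      have hue : u ∈ ends e := by rw [heends]; exact Sym2.mem_mk_right s u
      have hrest := conn_cut_of_walk hE hK w' ht htv (Or.inr ⟨e, Finset.mem_inter.2 ⟨heK, heE₁⟩, hue⟩)
      have hadj' : OpenAdj ends (ofFinset (K ∩ E₁)) s u :=
        ⟨e, ofFinset_eq_true_iff.2 (Finset.mem_inter.2 ⟨heK, heE₁⟩), heends⟩
      exact conn_trans (conn_of_openAdj hadj') hrest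
  · -- the reversed walk from `t`, with the roles of the parts exchanged
    have hK' : K ⊆ E₂ ∪ E₁ := by rw [Finset.union_comm]; exact hK
    have hc' : Conn ends (ofFinset (K ∩ E₂)) t v := by
      have wr := w.reverse
      cases wr with
      | nil => exact absurd rfl hst.symm
      | @cons _ u _ hadj w' =>
        rw [openGraph_adj] at hadj
        obtain ⟨_, e, heopen, heends⟩ := hadj
        have heK : e ∈ K := ofFinset_eq_true_iff.1 heopen
        have hte : t ∈ ends e := by rw [heends]; exact Sym2.mem_mk_left t u
        have heE₂ : e ∈ E₂ := by
          rcases Finset.mem_union.1 (hK heK) with h1 | h1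
          · exact absurd hte (ht e h1)
          · exact h1
        have hue : u ∈ ends e := by rw [heends]; exact Sym2.mem_mk_right t u
        have hrest := conn_cut_of_walk hE.symm hK' w' hs hsv (Or.inr ⟨e, Finset.mem_inter.2 ⟨heK, heE₂⟩, hue⟩)
        have hadj' : OpenAdj ends (ofFinset (K ∩ E₂)) t u :=
          ⟨e, ofFinset_eq_true_iff.2 (Finset.mem_inter.2 ⟨heK, heE₂⟩), heends⟩
        exact conn_trans (conn_of_openAdj hadj') hrest
    exact conn_symm hc'

omit [Fintype E] in
/-- a set carrying `s–v` together with a set carrying `v–t` carries `s–t` -/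
lemma carries_union_trans {ends : E → Sym2 V} {s v t : V} {K₁ K₂ : Finset E}
    (h₁ : Carries ends K₁ s v) (h₂ : Carries ends K₂ v t) : Carries ends (K₁ ∪ K₂) s t :=
  conn_trans (Carries.mono Finset.subset_union_left h₁) (Carries.mono Finset.subset_union_right h₂)

omit [Fintype E] in
/-- **series splitting of `k` disjoint witnesses** -/
lemma kDisj_series_split {ends : E → Sym2 V} {s v t : V} {E₁ E₂ : Finset E}
    (hE : SharesOnlyVertex ends v E₁ E₂) (hs : ∀ e ∈ E₂, s ∉ ends e) (ht : ∀ e ∈ E₁, t ∉ ends e)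
    (hsv : s ≠ v) (htv : t ≠ v) (hst : s ≠ t) :
    ∀ (k : ℕ) {S : Finset E}, S ⊆ E₁ ∪ E₂ → kDisj (fun S => Carries ends S s t) k S →
      kDisj (fun S => Carries ends S s v) k (S ∩ E₁) ∧ kDisj (fun S => Carries ends S v t) k (S ∩ E₂)
  | 0, _, _, _ => ⟨trivial, trivial⟩
  | k + 1, S, hS, h => by
      obtain ⟨K, L, hK, hL, hKL, hA, hB⟩ := h
      obtain ⟨hK₁, hK₂⟩ := carries_series_split hE hs ht hsv htv hst (hK.trans hS) (hA K le_rfl)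
      obtain ⟨hL₁, hL₂⟩ := kDisj_series_split hE hs ht hsv htv hst k (hL.trans hS) (hB L le_rfl)
      have hd : ∀ X : Finset E, Disjoint (K ∩ X) (L ∩ X) := fun X =>
        Finset.disjoint_of_subset_left Finset.inter_subset_left
          (Finset.disjoint_of_subset_right Finset.inter_subset_left hKL)
      exact ⟨⟨K ∩ E₁, L ∩ E₁, Finset.inter_subset_inter hK le_rfl, Finset.inter_subset_inter hL le_rfl, hd E₁,
          fun T hT => Carries.mono hT hK₁, fun T hT => incr_kDisj _ k hT hL₁⟩,
        ⟨K ∩ E₂, L ∩ E₂, Finset.inter_subset_inter hK le_rfl, Finset.inter_subset_inter hL le_rfl, hd E₂,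
          fun T hT => Carries.mono hT hK₂, fun T hT => incr_kDisj _ k hT hL₂⟩⟩

omit [Fintype E] in
/-- **series merging of `k` disjoint witnesses** -/
lemma kDisj_series_merge {ends : E → Sym2 V} {s v t : V} :
    ∀ (k : ℕ) {S₁ S₂ : Finset E}, Disjoint S₁ S₂ → kDisj (fun S => Carries ends S s v) k S₁ →
      kDisj (fun S => Carries ends S v t) k S₂ → kDisj (fun S => Carries ends S s t) k (S₁ ∪ S₂)
  | 0, _, _, _, _, _ => trivial
  | k + 1, S₁, S₂, hd, h₁, h₂ => by
      obtain ⟨K₁, L₁, hK₁, hL₁, hKL₁, hA₁, hB₁⟩ := h₁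
      obtain ⟨K₂, L₂, hK₂, hL₂, hKL₂, hA₂, hB₂⟩ := h₂
      have hrest := kDisj_series_merge k (Finset.disjoint_of_subset_left hL₁ (Finset.disjoint_of_subset_right hL₂ hd))
        (hB₁ L₁ le_rfl) (hB₂ L₂ le_rfl)
      refine ⟨K₁ ∪ K₂, L₁ ∪ L₂, Finset.union_subset_union hK₁ hK₂, Finset.union_subset_union hL₁ hL₂, ?_,
        fun T hT => Carries.mono hT (carries_union_trans (hA₁ K₁ le_rfl) (hA₂ K₂ le_rfl)),
        fun T hT => incr_kDisj _ k hT hrest⟩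
      rw [Finset.disjoint_union_left, Finset.disjoint_union_right, Finset.disjoint_union_right]
      exact ⟨⟨hKL₁, Finset.disjoint_of_subset_left hK₁ (Finset.disjoint_of_subset_right hL₂ hd)⟩,
        ⟨Finset.disjoint_of_subset_left hK₂ (Finset.disjoint_of_subset_right hL₁ hd.symm), hKL₂⟩⟩

end SeriesSplit

end Summit.Ventures.PercRepro2
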